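import Mathlib.Combinatorics.SimpleGraph.Metric
import Literature.Probability.Percolation.AnnulusCircuits
import HarnessLib

/-!
# Aizenman–Burchard's tortuosity lower bound for planar critical bond percolation (named fact, lattice form)

M. Aizenman, A. Burchard, *Hölder regularity and dimension bounds for random curves*, Duke Math. J. 99 (1999) 419–453.  Their Theorem 1.3
(Roughness): if a system of random curves satisfies hypothesis H2 (a power bound `K ρ^k` on the probability of simultaneous crossings of `k`
well-separated long cylinders), then there is `d_min > 1` such that for `r > 0` and `s` below `d_min` the capacity `T_{s,r;δ}` of all realised
curves of diameter `≥ r` stays stochastically bounded away from zero as the mesh `δ → 0`; with their (1.6)(ii) (`N(C,ℓ) ≥ Cap_{s;ℓ}(C)·ℓ^{-s}`)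
"the minimal number of steps of the lattice size needed in order to advance distance `L` exceeds `Const.(L/δ)^τ`", the constant being
stochastically bounded below.  Their §7: "In two dimensions, our hypotheses H1 and H2 are satisfied by the independent bond, site, and droplet
percolation models" (at criticality; RSW and the van den Berg–Kesten inequality).  The statement vendored here is the lattice reading on the annuli
`Λ(2n) ∖ Λ(n)` of `ℤ²` at `p = 1/2`: short open crossings are unlikely, uniformly in the scale.  NOT proved in the tree (named fact; consumer:
`Summits/CriticalPhenomena/PercolationContinuityZ3/Theorems/PercAnnulusCrossingIICChemicalSuperlinear.lean`, lane RSW3 p1 gen 16).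
-/

noncomputable section

namespace Literature.Probability.Percolation

open MeasureTheory LatticeModels

/-- **Aizenman–Burchard tortuosity bound for planar critical bond percolation (lattice form; named fact, not proved here).**  There are `s > 1`
and, for every `η > 0`, some `u > 0` such that for all large `n` the `P_{1/2}`-probability that some open path of the annulus `Λ(2n) ∖ Λ(n)`
(using only pairs of sites of the annulus) joins `∂ⁱⁿΛ(n+1)` to `∂ⁱⁿΛ(2n)` in at most `⌊u·n^s⌋` steps is at most `η` — the tightness form of
Aizenman–Burchard's Thm. 1.3 with (1.6)(ii), for 2D critical bond percolation (their §7). [cite: AizenmanBurchard1999, Thm. 1.3, eq. (1.6)(ii) and §7] -/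
def AizenmanBurchard1999_shortCrossings_half : Prop :=
  ∃ s : ℝ, 1 < s ∧ ∀ η : ℝ, 0 < η → ∃ u : ℝ, 0 < u ∧ ∃ n₀ : ℕ, ∀ n : ℕ, n₀ ≤ n →
    (bondPercolation (zdGraph 2) half).real
      {ω : BondConfig (Site 2) | ∃ a ∈ innerBoundary (zdGraph 2) (box 2 (n + 1)), ∃ v ∈ innerBoundary (zdGraph 2) (box 2 (2 * n)),
        (openGraph (ω ∩ ((↑(box 2 (2 * n)) : Set (Site 2)) \ ↑(box 2 n)).sym2)).edist a v ≤ ⌊u * (n : ℝ) ^ s⌋₊} ≤ η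

end Literature.Probability.Percolation

end
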